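import Literature.Barriers.Parity.SiegelZeroDichotomyPairHLProp71X
import Literature.Barriers.Parity.SiegelZeroDichotomyPairHLModifiedExpansion
import HarnessLib

/-!
# Tao–Teräväinen 2022, Proposition 7.1: the hyperbola sum in one residue class (`X + Y`)

Topic `Literature/Barriers/Parity`, sub-namespace `TaoTeravainen`; a file of the proof DAG of
`Literature.Barriers.Parity.TaoTeravainen2021_prop72_81_pair` (T. Tao, J. Teräväinen, *The
Hardy–Littlewood–Chowla conjecture in the presence of a Siegel zero*, J. London Math. Soc. (2) 106
(2022), arXiv:2109.06291), proof of Proposition 7.1 (i): "By Lemma 3.9, we can write the left-hand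
side of (7.5) as `X + Y` where `X := α ((a,q)q_χ, q)/q ∑_{n₁n₂ ∈ 𝒜} χ(n₁) Φ̃_t(n₂) ψ_I(n₁n₂)`,
`Y := ∑_{(u₁,u₂)} c_{u₁,u₂} ∑_{n₁,n₂} Φ̃_t(n₂) ψ_I(n₁n₂) e_q(u₁n₁ + u₂n₂)` … Using the divisor
bound … we can thus bound `|Y| ≪ x^{O(ε)} (a,q)^{3/2} q_χ^{7/2} q^{1/2}`." Everything here is
PROVED, with explicit constants, for the sum
`T(a') = ∑_{n₁,n₂ ≤ M} χ(n₁) G(n₁,n₂) 1_{n₁n₂ = a' (Q)}` (`G = Φ̃_t(n₂)ψ_I(n₁n₂)` = `hypWeight`):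

* `hypCongrSum` (`T(a')`), `hypFreqSum` (`W(u) = ∑ G(n₁,n₂) e_Q(u₁n₁+u₂n₂)`) and
  `hypCongrSum_decomp` — Lemma 3.9 applied with `f(n₁,n₂) = χ(n₁)`:
  `T(a') = ρ₀ X + ∑_u c_u W(u)`;
* `norm_sum_coeff_mul_hypFreqSum_le` — **the `Y`-bound**
  `|∑_u c_u W(u)| ≤ 8 C_{3.8} M_Δ · (Q²/4) τ(Q)² (1 + log Q)²`
  (`C_{3.8} = τ(q₀)² q₀^{3/2} τ(Q) Q^{-3/2}`, `M_Δ = ∑ |Δ₁Δ₂G|`);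
* `abs_mainTermX_le` — **the `X`-bound** `|X| ≤ τ(Q) (TB(L₀) + PB(L₀))` from the two bounds of
  `SiegelZeroDichotomyPairHLProp71X.lean`, splitting the divisors `e` according to
  `[q₀', g'e] ≥ L₀` or `< L₀`;
* `abs_hypCongrSum_le` — the two combined.
  [cite: TaoTeravainen2021, proof of Proposition 7.1 (X + Y decomposition)]
-/

noncomputable section

open Finset Real MeasureTheory
open scoped ContDiff

namespace Literature.Barriers.Parity

namespace TaoTeravainen

open Literature.Analysis.Calculus

open ArithmeticFunction (moebius)
open Literature.NumberTheory.Sieve.LargeSieve (e e_nat_mul norm_e e_div_eq_stdAddChar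
  norm_e_sub_one)

variable {q : ℕ}

/-! ### The objects -/

/-- `T(a') = ∑_{n₁,n₂ ≤ M} χ(n₁) G(n₁,n₂) 1_{n₁n₂ = a' mod Q}` — the left side of (7.5) after the
reduction to sub-progressions. [cite: TaoTeravainen2021, proof of Proposition 7.1, (7.5)] -/
def hypCongrSum (χ : DirichletCharacter ℂ q) (φ : ℝ → ℝ) (A B Δ v : ℝ) (M Q : ℕ) (a' : ZMod Q) : ℝ :=
  ∑ n₁ ∈ Icc 1 M, ∑ n₂ ∈ Icc 1 M, realChar χ n₁ * hypWeight φ A B Δ v n₁ n₂ *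
    (if ((n₁ * n₂ : ℕ) : ZMod Q) = a' then 1 else 0)

/-- `W(u) = ∑_{n₁,n₂ ≤ M} G(n₁,n₂) e_Q(u₁n₁ + u₂n₂)`. [cite: TaoTeravainen2021, proof of
Proposition 7.1 (the quantity Y)] -/
def hypFreqSum (φ : ℝ → ℝ) (A B Δ v : ℝ) (M Q : ℕ) [NeZero Q] (u : ZMod Q × ZMod Q) : ℂ :=
  ∑ n₁ ∈ Icc 1 M, ∑ n₂ ∈ Icc 1 M,
    (hypWeight φ A B Δ v n₁ n₂ : ℂ) * eQ u (((n₁ : ℕ) : ZMod Q), ((n₂ : ℕ) : ZMod Q))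

/-! ### Lemma 3.9 applied -/

/-- `gcd(N mod Q, Q) = gcd(N, Q)`. [folklore] -/
theorem gcd_val_natCast (Q : ℕ) [NeZero Q] (N : ℕ) : Nat.gcd ((N : ZMod Q).val) Q = Nat.gcd N Q := by
  rw [ZMod.val_natCast, ← Nat.gcd_rec, Nat.gcd_comm]

/-- **`T(a') = ρ₀ X + ∑_u c_u W(u)`** (Lemma 3.9 with `f(n₁,n₂) = χ(n₁)`, which is `1`-bounded and
`q₀`-periodic in each variable since `q ∣ q₀`). [cite: TaoTeravainen2021, proof of Proposition 7.1
("By Lemma 3.9, we can write the left-hand side of (7.5) as X + Y")] -/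
theorem hypCongrSum_decomp (χ : DirichletCharacter ℂ q) (φ : ℝ → ℝ) (A B Δ v : ℝ) (M : ℕ)
    {Q : ℕ} [NeZero Q] (hqQ : q ∣ Q) {q₀ : ℕ} (hq₀ : q₀ ∣ Q) (hqq₀ : q ∣ q₀) {a' : ZMod Q}
    (ha : Nat.gcd a'.val Q ∣ q₀) :
    ∃ (ρ₀ : ℝ) (c : ZMod Q × ZMod Q → ℂ),
      0 ≤ ρ₀ ∧ ρ₀ * Q ≤ (Nat.gcd (q₀ * a'.val) Q : ℝ) * (Nat.divisors Q).card ∧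
      (∀ u : ZMod Q × ZMod Q, (u.1 = 0 ∨ u.2 = 0) → c u = 0) ∧
      (∀ u : ZMod Q × ZMod Q, ‖c u‖ ≤ 2 * (((Nat.divisors q₀).card : ℝ) ^ 2 * ((q₀ : ℝ) * Real.sqrt q₀) *
        (Nat.divisors Q).card * Real.sqrt (Nat.gcd (Nat.gcd u.1.val u.2.val) Q) /
          ((Q : ℝ) * Real.sqrt Q))) ∧
      ((hypCongrSum χ φ A B Δ v M Q a' : ℝ) : ℂ) =
        ((ρ₀ * mainTermX χ φ A B Δ v M (Nat.gcd (q₀ * a'.val) Q) Q (Nat.gcd a'.val Q) a'.val : ℝ) : ℂ) +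
          ∑ u : ZMod Q × ZMod Q, c u * hypFreqSum φ A B Δ v M Q u := by
  have hQ0 : Q ≠ 0 := NeZero.ne Q
  -- the function `f(n) = χ(n₁)`
  set f : ZMod Q × ZMod Q → ℂ := fun n => (realChar χ n.1.val : ℂ) with hf
  have hf1 : ∀ n, ‖f n‖ ≤ 1 := fun n => by
    rw [hf]; simp only [Complex.norm_real, Real.norm_eq_abs]; exact abs_realChar_le_one χ _
  have hfp₁ : ∀ n, f (n + ((q₀ : ZMod Q), 0)) = f n := by
    intro n
    -- `(n.1 + q₀).val ≡ n.1.val (mod q)`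
    have h1 : ((n.1 + (q₀ : ZMod Q)).val : ZMod Q) = ((n.1.val + q₀ : ℕ) : ZMod Q) := by
      push_cast; simp
    have h2 : (n.1 + (q₀ : ZMod Q)).val ≡ n.1.val + q₀ [MOD Q] := (ZMod.natCast_eq_natCast_iff _ _ _).mp h1
    have h3 : (n.1 + (q₀ : ZMod Q)).val ≡ n.1.val + q₀ [MOD q] := h2.of_dvd hqQ
    have h4 : n.1.val + q₀ ≡ n.1.val [MOD q] := by
      have : n.1.val + q₀ ≡ n.1.val + 0 [MOD q] :=
        Nat.ModEq.add_left _ (Nat.modEq_zero_iff_dvd.mpr hqq₀)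
      simpa using this
    simp only [hf, Prod.fst_add]
    rw [realChar_congr χ (h3.trans h4)]
  have hfp₂ : ∀ n, f (n + (0, (q₀ : ZMod Q))) = f n := by
    intro n; simp only [hf, Prod.fst_add, add_zero]
  obtain ⟨ρ₀, c, hρ₀, hρQ, hc0, hcb, hexp⟩ := modifiedFourierExpansion hq₀ ha hf1 hfp₁ hfp₂
  refine ⟨ρ₀, c, hρ₀, hρQ, fun u hu => hc0 u ?_, hcb, ?_⟩
  · rcases hu with hu | hu
    · left; rw [hu, zero_mul]
    · right; rw [hu, zero_mul]
  -- the identity, term by term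
  have hterm : ∀ n₁ n₂ : ℕ,
      ((realChar χ n₁ * hypWeight φ A B Δ v n₁ n₂ *
          (if ((n₁ * n₂ : ℕ) : ZMod Q) = a' then 1 else 0) : ℝ) : ℂ) =
        ((ρ₀ * (realChar χ n₁ * hypWeight φ A B Δ v n₁ n₂ *
            (if n₁ * n₂ ≡ a'.val [MOD Nat.gcd (q₀ * a'.val) Q] ∧
              Nat.gcd (n₁ * n₂) Q = Nat.gcd a'.val Q then 1 else 0)) : ℝ) : ℂ) +
          ∑ u : ZMod Q × ZMod Q, c u * ((hypWeight φ A B Δ v n₁ n₂ : ℂ) *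
            eQ u (((n₁ : ℕ) : ZMod Q), ((n₂ : ℕ) : ZMod Q))) := by
    intro n₁ n₂
    have h := hexp (((n₁ : ℕ) : ZMod Q), ((n₂ : ℕ) : ZMod Q))
    simp only at h
    -- identify the pieces
    have hprod : ((n₁ : ℕ) : ZMod Q) * ((n₂ : ℕ) : ZMod Q) = ((n₁ * n₂ : ℕ) : ZMod Q) := by push_cast; rfl
    have hfn : f (((n₁ : ℕ) : ZMod Q), ((n₂ : ℕ) : ZMod Q)) = (realChar χ n₁ : ℂ) := by
      simp only [hf]
      rw [realChar_congr χ (n' := n₁) (by rw [ZMod.val_natCast]; exact (Nat.mod_modEq n₁ Q).of_dvd hqQ)]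
    have hcond : (((n₁ * n₂ : ℕ) : ZMod Q)).val ≡ a'.val [MOD Nat.gcd (q₀ * a'.val) Q] ∧
        Nat.gcd (((n₁ * n₂ : ℕ) : ZMod Q)).val Q = Nat.gcd a'.val Q ↔
        (n₁ * n₂ ≡ a'.val [MOD Nat.gcd (q₀ * a'.val) Q] ∧ Nat.gcd (n₁ * n₂) Q = Nat.gcd a'.val Q) := by
      rw [gcd_val_natCast, ZMod.val_natCast]
      have hmod : (n₁ * n₂) % Q ≡ n₁ * n₂ [MOD Nat.gcd (q₀ * a'.val) Q] :=
        (Nat.mod_modEq _ Q).of_dvd (Nat.gcd_dvd_right _ _)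
      exact ⟨fun ⟨h1, h2⟩ => ⟨hmod.symm.trans h1, h2⟩, fun ⟨h1, h2⟩ => ⟨hmod.trans h1, h2⟩⟩
    rw [hprod, hfn] at h
    simp only [hcond] at h
    -- bring `G` out of the `u`-sum and split the two indicators
    have hsum : ∑ u : ZMod Q × ZMod Q, c u * ((hypWeight φ A B Δ v n₁ n₂ : ℂ) *
        eQ u (((n₁ : ℕ) : ZMod Q), ((n₂ : ℕ) : ZMod Q))) =
        (hypWeight φ A B Δ v n₁ n₂ : ℂ) * ∑ u : ZMod Q × ZMod Q, c u * eQ u (((n₁ : ℕ) : ZMod Q), ((n₂ : ℕ) : ZMod Q)) := by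
      rw [mul_sum]; exact sum_congr rfl fun u _ => by ring
    rw [hsum]
    split_ifs with hc1 hc2 hc2
    · rw [if_pos hc1, if_pos hc2] at h
      push_cast
      linear_combination (hypWeight φ A B Δ v n₁ n₂ : ℂ) * h
    · rw [if_pos hc1, if_neg hc2] at h
      push_cast
      linear_combination (hypWeight φ A B Δ v n₁ n₂ : ℂ) * h
    · rw [if_neg hc1, if_pos hc2] at h
      push_cast
      linear_combination (hypWeight φ A B Δ v n₁ n₂ : ℂ) * h
    · rw [if_neg hc1, if_neg hc2] at h
      push_cast
      linear_combination (hypWeight φ A B Δ v n₁ n₂ : ℂ) * h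
  unfold hypCongrSum hypFreqSum mainTermX
  simp only [Complex.ofReal_sum]
  simp_rw [hterm]
  rw [sum_congr rfl fun n₁ _ => sum_add_distrib, sum_add_distrib]
  congr 1
  · rw [Complex.ofReal_mul, Complex.ofReal_sum, mul_sum]
    refine sum_congr rfl fun n₁ _ => ?_
    rw [Complex.ofReal_sum, mul_sum]
    refine sum_congr rfl fun n₂ _ => ?_
    rw [Complex.ofReal_mul]
  · -- swap the `u`-sum out
    simp_rw [mul_sum]
    symm
    rw [Finset.sum_comm]
    exact Finset.sum_congr rfl fun n₁ _ => Finset.sum_comm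

/-! ### The `Y`-bound -/

/-- `∑_{n < M+1} g(n) = g(0) + ∑_{1 ≤ n ≤ M} g(n)`. [folklore] -/
theorem sum_range_succ_eq_add_sum_Icc {R : Type*} [AddCommMonoid R] (g : ℕ → R) (M : ℕ) :
    ∑ n ∈ range (M + 1), g n = g 0 + ∑ n ∈ Icc 1 M, g n := by
  induction M with
  | zero => simp
  | succ M ih =>
    rw [sum_range_succ, ih, Finset.sum_Icc_succ_top (Nat.le_add_left 1 M), add_assoc]

/-- `e_Q(u₁n₁ + u₂n₂) = e(u₁/Q)^{n₁} e(u₂/Q)^{n₂}` at natural numbers. [folklore] -/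
theorem eQ_natCast_eq_pow {Q : ℕ} [NeZero Q] (u : ZMod Q × ZMod Q) (n₁ n₂ : ℕ) :
    eQ u (((n₁ : ℕ) : ZMod Q), ((n₂ : ℕ) : ZMod Q)) =
      e ((u.1.val : ℝ) / Q) ^ n₁ * e ((u.2.val : ℝ) / Q) ^ n₂ := by
  unfold eQ
  rw [AddChar.map_add_eq_mul]
  have h : ∀ (w : ZMod Q) (n : ℕ), ZMod.stdAddChar (w * ((n : ℕ) : ZMod Q)) = e ((w.val : ℝ) / Q) ^ n := by
    intro w n
    have h1 : w * ((n : ℕ) : ZMod Q) = ((w.val : ℕ) : ZMod Q) * ((n : ℤ) : ZMod Q) := by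
      rw [ZMod.natCast_zmod_val, Int.cast_natCast]
    rw [h1, ← e_div_eq_stdAddChar (q := Q) w.val (n : ℤ), ← e_nat_mul]
    congr 1
    push_cast
    ring
  rw [h u.1 n₁, h u.2 n₂]

/-- `W(u)` as a double power sum over `{0, …, M}²` (the `n = 0` terms vanish). [folklore] -/
theorem hypFreqSum_eq_pow_sum (φ : ℝ → ℝ) {A B Δ : ℝ} (hA : 0 ≤ A) (hΔ : 0 < Δ) (v : ℝ) (M Q : ℕ)
    [NeZero Q] (u : ZMod Q × ZMod Q) :
    hypFreqSum φ A B Δ v M Q u =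
      ∑ n₁ ∈ range (M + 1), ∑ n₂ ∈ range (M + 1),
        hypWeightC φ A B Δ v n₁ n₂ * e ((u.1.val : ℝ) / Q) ^ n₁ * e ((u.2.val : ℝ) / Q) ^ n₂ := by
  unfold hypFreqSum hypWeightC
  rw [sum_range_succ_eq_add_sum_Icc]
  have h0 : ∑ n₂ ∈ range (M + 1), (hypWeight φ A B Δ v 0 n₂ : ℂ) * e ((u.1.val : ℝ) / Q) ^ 0 *
      e ((u.2.val : ℝ) / Q) ^ n₂ = 0 :=
    sum_eq_zero fun n₂ _ => by rw [hypWeight_zero_left hA hΔ, Complex.ofReal_zero, zero_mul, zero_mul]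
  rw [h0, zero_add]
  refine sum_congr rfl fun n₁ _ => ?_
  rw [sum_range_succ_eq_add_sum_Icc, hypWeight_zero_right, Complex.ofReal_zero, zero_mul, zero_mul,
    zero_add]
  refine sum_congr rfl fun n₂ _ => ?_
  rw [eQ_natCast_eq_pow, mul_assoc]

/-- `e(w/Q) ≠ 1` and `|e(w/Q)| = 1` for `w ≠ 0` in `ZMod Q`. [folklore] -/
theorem e_val_div_ne_one {Q : ℕ} [NeZero Q] {w : ZMod Q} (hw : w ≠ 0) : e ((w.val : ℝ) / Q) ≠ 1 := by
  intro h
  have hn : ‖e ((w.val : ℝ) / Q) - 1‖ = 0 := by rw [h, sub_self, norm_zero]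
  rw [norm_e_sub_one] at hn
  have hQ : (0 : ℝ) < Q := by exact_mod_cast Nat.pos_of_ne_zero (NeZero.ne Q)
  have h0 : 0 < w.val := Nat.pos_of_ne_zero ((ZMod.val_ne_zero w).mpr hw)
  have h1 : w.val < Q := ZMod.val_lt w
  have hs : 0 < Real.sin (π * ((w.val : ℝ) / Q)) := by
    refine Real.sin_pos_of_pos_of_lt_pi (by positivity) ?_
    have : (w.val : ℝ) / Q < 1 := by rw [div_lt_one hQ]; exact_mod_cast h1
    nlinarith [Real.pi_pos]
  have : |Real.sin (π * ((w.val : ℝ) / Q))| = 0 := by linarith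
  rw [abs_eq_zero] at this
  linarith

/-- **The `Y`-bound**: with the coefficients of Lemma 3.9 (vanishing for `u₁ = 0` or `u₂ = 0` and
bounded by `2 C √(u₁,u₂,Q)`, `C = τ(q₀)² q₀^{3/2} τ(Q)/(Q√Q)`), `0 ≤ A`, `Δ > 0`,
`|∑_u c_u W(u)| ≤ 8 C M_Δ · (Q²/4) τ(Q)² (1 + log Q)²`, `M_Δ = ∑_{j₁,j₂ ≥ 1} |Δ₁Δ₂G(j₁,j₂)|`
("Using the divisor bound … we can thus bound `|Y| ≪ x^{O(ε)} (a,q)^{3/2} q_χ^{7/2} q^{1/2}`").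
[cite: TaoTeravainen2021, proof of Proposition 7.1 (the estimate for Y)] -/
theorem norm_sum_coeff_mul_hypFreqSum_le (φ : ℝ → ℝ) {A B Δ : ℝ} (hA : 0 ≤ A) (hΔ : 0 < Δ) (v : ℝ)
    (M Q : ℕ) [NeZero Q] {c : ZMod Q × ZMod Q → ℂ} {C : ℝ} (hC : 0 ≤ C)
    (hc0 : ∀ u : ZMod Q × ZMod Q, (u.1 = 0 ∨ u.2 = 0) → c u = 0)
    (hcb : ∀ u : ZMod Q × ZMod Q, ‖c u‖ ≤ 2 * (C * Real.sqrt (Nat.gcd (Nat.gcd u.1.val u.2.val) Q))) :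
    ‖∑ u : ZMod Q × ZMod Q, c u * hypFreqSum φ A B Δ v M Q u‖ ≤
      8 * C * (∑ j₁ ∈ Icc 1 M, ∑ j₂ ∈ Icc 1 M, ‖mixedDiff (hypWeightC φ A B Δ v) j₁ j₂‖) *
        ((Q : ℝ) ^ 2 / 4 * (Nat.divisors Q).card ^ 2 * (1 + Real.log Q) ^ 2) := by
  set MΔ : ℝ := ∑ j₁ ∈ Icc 1 M, ∑ j₂ ∈ Icc 1 M, ‖mixedDiff (hypWeightC φ A B Δ v) j₁ j₂‖ with hMΔ
  have hMΔ0 : 0 ≤ MΔ := sum_nonneg fun _ _ => sum_nonneg fun _ _ => norm_nonneg _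
  -- termwise bound
  have hterm : ∀ u : ZMod Q × ZMod Q, ‖c u * hypFreqSum φ A B Δ v M Q u‖ ≤
      8 * C * MΔ * (if u.1 = 0 ∨ u.2 = 0 then 0 else
        Real.sqrt (Nat.gcd (Nat.gcd u.1.val u.2.val) Q) /
          (‖e ((u.1.val : ℝ) / Q) - 1‖ * ‖e ((u.2.val : ℝ) / Q) - 1‖)) := by
    intro u
    by_cases hu : u.1 = 0 ∨ u.2 = 0
    · rw [if_pos hu, hc0 u hu, zero_mul, norm_zero, mul_zero]
    · rw [if_neg hu]
      push Not at hu
      have hz₁ := e_val_div_ne_one hu.1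
      have hz₂ := e_val_div_ne_one hu.2
      have hW := norm_sum_hypWeightC_mul_pow_le φ (B := B) hA hΔ v M (norm_e _) hz₁ (norm_e _) hz₂
      rw [← hypFreqSum_eq_pow_sum φ hA hΔ v M Q u] at hW
      rw [norm_mul]
      have hd : 0 < ‖e ((u.1.val : ℝ) / Q) - 1‖ * ‖e ((u.2.val : ℝ) / Q) - 1‖ :=
        mul_pos (norm_pos_iff.mpr (sub_ne_zero.mpr hz₁)) (norm_pos_iff.mpr (sub_ne_zero.mpr hz₂))
      calc ‖c u‖ * ‖hypFreqSum φ A B Δ v M Q u‖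
          ≤ (2 * (C * Real.sqrt (Nat.gcd (Nat.gcd u.1.val u.2.val) Q))) *
              (4 / (‖e ((u.1.val : ℝ) / Q) - 1‖ * ‖e ((u.2.val : ℝ) / Q) - 1‖) * MΔ) :=
            mul_le_mul (hcb u) hW (norm_nonneg _) (by positivity)
        _ = _ := by
            field_simp
            ring
  calc ‖∑ u : ZMod Q × ZMod Q, c u * hypFreqSum φ A B Δ v M Q u‖
      ≤ ∑ u : ZMod Q × ZMod Q, ‖c u * hypFreqSum φ A B Δ v M Q u‖ := norm_sum_le _ _
    _ ≤ ∑ u : ZMod Q × ZMod Q, 8 * C * MΔ * (if u.1 = 0 ∨ u.2 = 0 then 0 else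
        Real.sqrt (Nat.gcd (Nat.gcd u.1.val u.2.val) Q) /
          (‖e ((u.1.val : ℝ) / Q) - 1‖ * ‖e ((u.2.val : ℝ) / Q) - 1‖)) := sum_le_sum fun u _ => hterm u
    _ = 8 * C * MΔ * ∑ u : ZMod Q × ZMod Q, (if u.1 = 0 ∨ u.2 = 0 then 0 else
        Real.sqrt (Nat.gcd (Nat.gcd u.1.val u.2.val) Q) /
          (‖e ((u.1.val : ℝ) / Q) - 1‖ * ‖e ((u.2.val : ℝ) / Q) - 1‖)) := by rw [← mul_sum]
    _ ≤ 8 * C * MΔ * ((Q : ℝ) ^ 2 / 4 * (Nat.divisors Q).card ^ 2 * (1 + Real.log Q) ^ 2) :=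
        mul_le_mul_of_nonneg_left (sum_sqrt_gcd_div_le Q) (by positivity)

/-! ### The `X`-bound -/

/-- **The `X`-bound**: for `Q ≠ 0`, `g' ∣ Q`, `g' ∣ q₀'`, `g' ∣ r`, `q ∣ q₀'`, `0 < L₀`, and the
hypotheses of the two `X_e`-bounds, `|X| ≤ τ(Q) (TB(L₀) + PB(L₀))` where
`TB(L) = B₁ C_δ B^δ (B/L + 2)` and `PB(L) = (π²/3)(2π)^{-m}(B-A)(I_m L^m e^{-vm} + B₁ K_m (L e^{v+1}/Δ)^m)`
("For those `q₁` with `q₁ > D^{1/2}q_χ²x^{-4ε}` we simply use the triangle inequality … Now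
suppose instead that `q₁ ≤ D^{1/2}q_χ²x^{-4ε}` … We thus have `X ≪_A x^{-A}`").
[cite: TaoTeravainen2021, proof of Proposition 7.1 (the estimate for X)] -/
theorem abs_mainTermX_le (χ : DirichletCharacter ℂ q) {φ : ℝ → ℝ} (hφ : IsBump φ) {B₁ : ℝ}
    (hB₁ : ∀ u, |deriv φ u| ≤ B₁) {A B Δ v : ℝ} (hΔ : 0 < Δ) (hAB : A ≤ B) (hB : 0 ≤ B)
    (hv : 2 ≤ v) {M : ℕ} (hvM : Real.exp (v + 1) ≤ M) (hvA : Real.exp (v + 1) ≤ 2 * A)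
    (hBM : B ≤ M) {Q g' q₀' r : ℕ} (hQ : Q ≠ 0) (hg'Q : g' ∣ Q) (hg'q : g' ∣ q₀') (hg'r : g' ∣ r)
    (hq₀Q : q₀' ∣ Q) (hqq : q ∣ q₀') {m : ℕ} (hm : 2 ≤ m) {δ Cδ : ℝ} (hδ : 0 < δ) (hC0 : 0 ≤ Cδ)
    (hCδ : ∀ n : ℕ, n ≠ 0 → (n.divisors.card : ℝ) ≤ Cδ * (n : ℝ) ^ δ) {L₀ : ℝ} (hL₀ : 0 < L₀) :
    |mainTermX χ φ A B Δ v M q₀' Q g' r| ≤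
      (Q.divisors.card : ℝ) *
        (B₁ * (Cδ * B ^ δ) * (B / L₀ + 2) +
          (π ^ 2 / 3) / (2 * π) ^ m * (B - A) *
            (logBumpNorm φ m * L₀ ^ m * Real.exp (-v) ^ m +
              B₁ * plateauDerivConst m * (L₀ * Real.exp (v + 1) / Δ) ^ m)) := by
  have hB₁0 : 0 ≤ B₁ := (abs_nonneg _).trans (hB₁ 0)
  have hg'0 : 0 < g' := Nat.pos_of_ne_zero fun h => hQ (Nat.eq_zero_of_zero_dvd (h ▸ hg'Q))
  have hq₀0 : 0 < q₀' := Nat.pos_of_ne_zero fun h => hQ (Nat.eq_zero_of_zero_dvd (h ▸ hq₀Q))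
  have hQg : Q / g' ≠ 0 := (Nat.div_pos (Nat.le_of_dvd (Nat.pos_of_ne_zero hQ) hg'Q) hg'0).ne'
  set TB : ℝ := B₁ * (Cδ * B ^ δ) * (B / L₀ + 2) with hTB
  set PB : ℝ := (π ^ 2 / 3) / (2 * π) ^ m * (B - A) *
    (logBumpNorm φ m * L₀ ^ m * Real.exp (-v) ^ m +
      B₁ * plateauDerivConst m * (L₀ * Real.exp (v + 1) / Δ) ^ m) with hPB
  have hI0 : 0 ≤ logBumpNorm φ m := integral_nonneg fun y => norm_nonneg _
  have hK0 := plateauDerivConst_nonneg m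
  have hBA : 0 ≤ B - A := by linarith
  have hTB0 : 0 ≤ TB := by positivity
  have hPB0 : 0 ≤ PB := by positivity
  -- per divisor `e`
  have hXe : ∀ e ∈ (Q / g').divisors, |mainTermXe χ φ A B Δ v M q₀' (g' * e) r| ≤ TB + PB := by
    intro e he
    have he0 : 0 < e := Nat.pos_of_mem_divisors he
    have hE : 0 < g' * e := Nat.mul_pos hg'0 he0
    set L : ℕ := Nat.lcm q₀' (g' * e) with hLdef
    have hL : 0 < L := Nat.lcm_pos hq₀0 hE
    have hLr : (0 : ℝ) < L := by exact_mod_cast hL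
    have hqL : q ∣ L := hqq.trans (Nat.dvd_lcm_left _ _)
    by_cases hcase : L₀ ≤ (L : ℝ)
    · -- trivial bound, decreasing in `L`
      have h := abs_mainTermXe_le_trivial χ hB₁ (A := A) hB hΔ v M hq₀0 hE r hδ hC0 hCδ
      refine h.trans (le_add_of_le_of_nonneg ?_ hPB0)
      rw [hTB]
      gcongr
    · -- Poisson bound, increasing in `L`
      push Not at hcase
      have h := abs_mainTermXe_le_poisson χ hφ hB₁ hΔ hAB hv hvM hvA hBM hq₀0 hE hqL r hm
      refine h.trans (le_add_of_nonneg_of_le hTB0 ?_)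
      rw [hPB]
      have hT0 : 0 ≤ Real.exp (v + 1) := (Real.exp_pos _).le
      gcongr
  -- sum over `e`
  rw [mainTermX_eq_sum_moebius χ φ A B Δ v M hQ hg'Q hg'q hg'r]
  calc |∑ e ∈ (Q / g').divisors, (moebius e : ℝ) * mainTermXe χ φ A B Δ v M q₀' (g' * e) r|
      ≤ ∑ e ∈ (Q / g').divisors, |(moebius e : ℝ) * mainTermXe χ φ A B Δ v M q₀' (g' * e) r| :=
        abs_sum_le_sum_abs _ _
    _ ≤ ∑ e ∈ (Q / g').divisors, (TB + PB) := by
        refine sum_le_sum fun e he => ?_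
        rw [abs_mul]
        calc |(moebius e : ℝ)| * |mainTermXe χ φ A B Δ v M q₀' (g' * e) r| ≤ 1 * (TB + PB) := by
              refine mul_le_mul ?_ (hXe e he) (abs_nonneg _) zero_le_one
              have := ArithmeticFunction.abs_moebius_le_one (n := e)
              exact_mod_cast this
          _ = TB + PB := one_mul _
    _ = ((Q / g').divisors.card : ℝ) * (TB + PB) := by rw [sum_const, nsmul_eq_mul]
    _ ≤ (Q.divisors.card : ℝ) * (TB + PB) := by
        refine mul_le_mul_of_nonneg_right ?_ (by positivity)
        exact_mod_cast card_le_card (Nat.divisors_subset_of_dvd hQ (Nat.div_dvd_of_dvd hg'Q))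

/-! ### The combined bound -/

/-- **Proposition 7.1, core estimate**: for `T(a') = ∑_{n₁,n₂ ≤ M} χ(n₁)G(n₁,n₂)1_{n₁n₂ = a' (Q)}`
with `q ∣ q₀ ∣ Q`, `(a',Q) ∣ q₀`:
`|T(a')| ≤ (q₀'τ(Q)/Q) · τ(Q)(TB(L₀) + PB(L₀)) + 8 C_{3.8} M_Δ (Q²/4)τ(Q)²(1+log Q)²`.
[cite: TaoTeravainen2021, proof of Proposition 7.1 (X + Y)] -/
theorem abs_hypCongrSum_le (χ : DirichletCharacter ℂ q) {φ : ℝ → ℝ} (hφ : IsBump φ) {B₁ : ℝ}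
    (hB₁ : ∀ u, |deriv φ u| ≤ B₁) {A B Δ v : ℝ} (hA : 0 ≤ A) (hΔ : 0 < Δ) (hAB : A ≤ B)
    (hv : 2 ≤ v) {M : ℕ} (hvM : Real.exp (v + 1) ≤ M) (hvA : Real.exp (v + 1) ≤ 2 * A)
    (hBM : B ≤ M) {Q : ℕ} [NeZero Q] (hqQ : q ∣ Q) {q₀ : ℕ} (hq₀ : q₀ ∣ Q) (hqq₀ : q ∣ q₀)
    {a' : ZMod Q} (ha : Nat.gcd a'.val Q ∣ q₀) {m : ℕ} (hm : 2 ≤ m) {δ Cδ : ℝ} (hδ : 0 < δ)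
    (hC0 : 0 ≤ Cδ) (hCδ : ∀ n : ℕ, n ≠ 0 → (n.divisors.card : ℝ) ≤ Cδ * (n : ℝ) ^ δ) {L₀ : ℝ}
    (hL₀ : 0 < L₀) :
    |hypCongrSum χ φ A B Δ v M Q a'| ≤
      (Nat.gcd (q₀ * a'.val) Q : ℝ) * (Nat.divisors Q).card / Q *
        ((Q.divisors.card : ℝ) *
          (B₁ * (Cδ * B ^ δ) * (B / L₀ + 2) +
            (π ^ 2 / 3) / (2 * π) ^ m * (B - A) *
              (logBumpNorm φ m * L₀ ^ m * Real.exp (-v) ^ m +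
                B₁ * plateauDerivConst m * (L₀ * Real.exp (v + 1) / Δ) ^ m))) +
        8 * (((Nat.divisors q₀).card : ℝ) ^ 2 * ((q₀ : ℝ) * Real.sqrt q₀) * (Nat.divisors Q).card /
            ((Q : ℝ) * Real.sqrt Q)) *
          (∑ j₁ ∈ Icc 1 M, ∑ j₂ ∈ Icc 1 M, ‖mixedDiff (hypWeightC φ A B Δ v) j₁ j₂‖) *
          ((Q : ℝ) ^ 2 / 4 * (Nat.divisors Q).card ^ 2 * (1 + Real.log Q) ^ 2) := by
  have hQ0 : Q ≠ 0 := NeZero.ne Q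
  have hQr : (0 : ℝ) < Q := by exact_mod_cast Nat.pos_of_ne_zero hQ0
  have hB : 0 ≤ B := hA.trans hAB
  obtain ⟨ρ₀, c, hρ₀, hρQ, hc0, hcb, hdec⟩ := hypCongrSum_decomp χ φ A B Δ v M hqQ hq₀ hqq₀ ha
  -- the data for the X-bound
  set q₀' : ℕ := Nat.gcd (q₀ * a'.val) Q with hq₀'
  set g' : ℕ := Nat.gcd a'.val Q with hg'
  have hg'Q : g' ∣ Q := Nat.gcd_dvd_right _ _
  have hg'q : g' ∣ q₀' := Nat.dvd_gcd ((Nat.gcd_dvd_left _ _).trans (Dvd.intro_left _ rfl)) hg'Q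
  have hg'r : g' ∣ a'.val := Nat.gcd_dvd_left _ _
  have hq₀'Q : q₀' ∣ Q := Nat.gcd_dvd_right _ _
  have hqq : q ∣ q₀' := Nat.dvd_gcd (hqq₀.trans (Dvd.intro _ rfl)) hqQ
  have hX := abs_mainTermX_le χ hφ hB₁ hΔ hAB hB hv hvM hvA hBM hQ0 hg'Q hg'q hg'r hq₀'Q hqq hm hδ
    hC0 hCδ hL₀
  -- the Y-bound
  set C : ℝ := ((Nat.divisors q₀).card : ℝ) ^ 2 * ((q₀ : ℝ) * Real.sqrt q₀) * (Nat.divisors Q).card /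
    ((Q : ℝ) * Real.sqrt Q) with hC
  have hC0' : 0 ≤ C := by positivity
  have hcb' : ∀ u : ZMod Q × ZMod Q, ‖c u‖ ≤ 2 * (C * Real.sqrt (Nat.gcd (Nat.gcd u.1.val u.2.val) Q)) := by
    intro u
    refine (hcb u).trans (le_of_eq ?_)
    rw [hC]
    ring
  have hY := norm_sum_coeff_mul_hypFreqSum_le φ (B := B) hA hΔ v M Q hC0' hc0 hcb'
  -- combine via the complex identity
  have hnorm : |hypCongrSum χ φ A B Δ v M Q a'| =
      ‖((hypCongrSum χ φ A B Δ v M Q a' : ℝ) : ℂ)‖ := by rw [Complex.norm_real, Real.norm_eq_abs]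
  rw [hnorm, hdec]
  refine (norm_add_le _ _).trans (add_le_add ?_ hY)
  rw [Complex.norm_real, Real.norm_eq_abs, abs_mul, abs_of_nonneg hρ₀]
  have hρle : ρ₀ ≤ (q₀' : ℝ) * (Nat.divisors Q).card / Q := by
    rw [le_div_iff₀ hQr]; exact hρQ
  calc ρ₀ * |mainTermX χ φ A B Δ v M q₀' Q g' a'.val|
      ≤ ((q₀' : ℝ) * (Nat.divisors Q).card / Q) * _ :=
        mul_le_mul hρle hX (abs_nonneg _) (by positivity)
    _ = _ := rfl


end TaoTeravainen

end Literature.Barriers.Parity
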